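import Literature.MathematicalPhysics.QuantumFieldTheory.Balaban1983to89.B9SectBGpLettersY
import Literature.MathematicalPhysics.QuantumFieldTheory.Balaban1983to89.B9SectBGpStepAtLettersV2
import Literature.MathematicalPhysics.QuantumFieldTheory.Balaban1983to89.B9RWSums347DefiniteFacesWindow

/-!
# `Balaban1983to89.B9SectBGpFrameCodedY` — ★★ THE ROOT SECT.-B FRAME `GpFrame₂` INHABITED OVER THE CODED CARRIER of the record family from
# NODE 00's letters, MODULO three named statements: the class (3.37) in letters form and the two conj-`b` (3.42) reading∕writing dictionaries

T. Bałaban, *Propagators for lattice gauge theories in a background field*, Commun. Math. Phys. **99** (1985) 389–434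
[`Balaban1985BackgroundPropagators`, "B9"]; [4] = T. Bałaban, *Propagators and renormalization transformations for lattice gauge
theories. II*, Commun. Math. Phys. **96** (1984) 223–250 [`Balaban1984PropagatorsII`].

statement-level skeleton of published theorems with citation tags; proofs where landed; nothing here is a claim about the
Yang–Mills mass gap

THE PRINTED LOCI.  Theorem 3.4 p. 400; Sect. B pp. 400–407 ((3.60) p. 402, p. 403 «of course with different constants»); Theorem 3.1 (3.42) p. 397;
(3.19) p. 393; (3.24)–(3.25) pp. 394–395; (3.35)–(3.37) p. 396; Theorem 3.11 p. 416; [4] Lemma 2.1 (2.59)–(2.61) pp. 233–234, (2.46) p. 231, (2.51) p. 232.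

WHY THIS FILE (pub-ymgap N06 row 13, seat dag-n06-c gen 7).  The row-13 entry point of record reads `hB` from ONE `F : SectBFrame₇ …` over the record's
carrier; by LOCATED-6 that frame — already its ROOT `B9SectBGpStepAtLettersV2.GpFrame₂` — has no instance there, and the repair is the coded carrier
`B9SectBCodedCarrier` (transfer `sectBStepPrinted_of_coded`).  THIS FILE INHABITS THE ROOT FRAME OVER THE CODED CARRIER of the record family
`x : MemberY …` (`geo9Y`, coding `codingYx G x C37 C38` of `bg9Y 𝔸 G x` by the fields `A′`, ANY kernel families `KC x` over the coded carriers (the pull-backs `pullK _ (K x)` of the record's, or augmented readings), real basis `b`, directions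
`Fin (d+1)`, fine carriers `SiteY`), with the letters of `B9SectBGpLettersY`:
* §1 `codingYx` (+ `codingYx_dec`: its decoding is `decY`);
* §2 THE THREE RESIDUAL NAMED STATEMENTS (definitions of `Prop`s, displayed as hypotheses of §3 — NOT proved here): `CplxLettersY G x par ιB Cq β U a`
  (the seven blockwise bounds the field `cplx` consumes: (3.58)∕(3.59) for `kFC`∕`sFC`, (3.37) read blockwise for `chartA a` — its covariant
  differences w.r.t. `coordC`, its values, its backward transports — at the scale of the labelled block), `Read342Y` ∕ `Write342Y` (the conj-`b`
  READING ∕ WRITING dictionaries between the (3.42) block `EBlock K …` of the family and block majorants of `GopC`, `∇♯_k·GopC`, `GopC·∇♯_k`, `LapC·GopC`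
  — the fields `read342` ∕ `write342` at NODE 00's letters);
* §3 `exists_d261` (n06-k's [4] Lemma-2.1 supplier `B9RWSums347DefiniteFacesWindow.ineq261_fn_geo9Y` at `αlo = 9/5000`) and ★★ `gpFrame₂Coded` — the
  `GpFrame₂` term: constants `a₀ = 1`, `d₀ = 2(d+1)`, `δcap = 1`, `Λf = L⁴`, `MST δ = 4 log L∕((9/5000)δ)`, `(d261, M261)` chosen from `exists_d261`;
  EVERY FIELD DISCHARGED from the tree except the three named statements and the structural data: geometry (`B9GeoLemma21KLevelV1`), `h261`∕`hST`
  (`ineq261_fn_geo9Y`, `scaleTransfer6_window_geo9Y`), `unitary`, stencils, (3.19)∕(3.24) sizes, `gop_eq`, `reg_inv` (from `hunit`), ★ `mul_law` ((3.60),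
  `B9Eq360DeltaPrimeAY` through `B9SectBGpLettersY.ΔpC_mul_law`), `cplx`∕`read342`∕`write342` := the named hypotheses at the decoded pair.
HYPOTHESES OF `gpFrame₂Coded` and their status at the record (`𝔸 = M_N(ℂ)`, `G = SU(N)`, `par x = parSymY x.toKIdx`, `KC x` = the pull-back of `(opsY…x).Gp` or an augmented reading of NODE 00's G′(U)):
`hι` (ιB a section of `β` — it exists iff the member is CORNER-FREE, `B9BetaRangeKLevelV1.surjective_beta_iff`; n06-k's `B9IndexBondFaithful.exists_faithful_kIdx`
maps fine bonds to index bonds and is NOT such a section — v1.1 correction after ref-E READ-1), `hG1` (G ≤ U(N): unitary matrices have norm 1), `hpar` (`Node00.parSymY_mem`),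
`hunit` (n06-j `B9Thm311DeltaPrimePos.isUnit_deltaPrimeAY_parSymY`), `hrepr` (any real basis of a finite-dimensional space), and the three named
statements `hC37` (⇐ (3.58) at NODE 00's contours + the chart transport of r06's `Cplx337` — OPEN), `hread`∕`hwrite` (the sup-over-ball ↔ conj-`b`
dictionary for `Node00.kernelFamilyS` — OPEN; κ-fold analogue: n06-d's `B9CoReadingCoordsS`).

HONEST SCOPE.  A frame INHABITED MODULO NAMED HYPOTHESES is not an unconditional instance; the block labels `ιB` are a SECTION of `β` (`hι`),
which exists exactly at the CORNER-FREE members (`B9BetaRangeKLevelV1.surjective_beta_iff`; ref-E READ-1∕10) — at a cornered member every statement displaying `hι`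
is vacuous (a quasi-section at bounded distance would serve the same estimates with larger constants; not done here; v1.1 doc-only note); the three named statements are Sect.-B∕Thm-3.1-side content
still owed; nothing of [B9] is asserted; no estimate is proved here; COUNT-NEUTRAL; N06 NOT discharged; one finite lattice programme — nothing
continuum ∕ OS ∕ mass-gap ∕ Clay.  Cell `pub-ymgap` (HUMAN RULING D-0062), Track A node N06 [B9], N06-ASSIGNMENT row 13, 2026-08-27.

RELATED IN THE TREE, NOT DUPLICATED: `B9SectBGpStepAtLettersV2` (`GpFrame₂` — INSTANTIATED, not modified), `B9SectBCodedCarrier` (`Coding`, `pullK`),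
`B9SectBGpLettersY` (letters + per-index laws), `B9RWSums347DefiniteFacesWindow` (`ineq261_fn_geo9Y`, `scaleTransfer6_window_geo9Y`, `geo9Y_dist_nonneg`),
`B9GeoLemma21KLevelV1` (`geo9Y_dist_*`, `geo9K_eta_pos`, `geo9K_one_le_L`) — USED BY NAME.
-/

noncomputable section

namespace Literature.MathematicalPhysics.QuantumFieldTheory.Balaban1983to89.B9SectBGpFrameCodedY

open Literature.MathematicalPhysics.QuantumFieldTheory.Balaban1983to89.B6RandomWalk (HasMajorant Triangle254 Ineq261)
open Literature.MathematicalPhysics.QuantumFieldTheory.Balaban1983to89.B9Thm34Ext (toB6)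
open Literature.MathematicalPhysics.QuantumFieldTheory.Balaban1983to89.B9Ineq347 (ScaleTransfer)
open Literature.MathematicalPhysics.QuantumFieldTheory.Balaban1983to89.B9Eq39Adjoint (covD covDstar fluct)
open Literature.MathematicalPhysics.QuantumFieldTheory.Balaban1983to89.B9Eq352DivForm (tauB)
open Literature.MathematicalPhysics.QuantumFieldTheory.Balaban1983to89.B9Eq352DivFormLetters (conj)
open Literature.MathematicalPhysics.QuantumFieldTheory.Balaban1983to89.B9Eq352GradLetters (diffLetter)
open Literature.MathematicalPhysics.QuantumFieldTheory.Balaban1983to89.B9Eq360VprimeLetters (vPrimeConc)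
open Literature.MathematicalPhysics.QuantumFieldTheory.Balaban1983to89.B9FromB6 (EBlock)
open Literature.MathematicalPhysics.QuantumFieldTheory.Balaban1983to89.B9SectBGpStepAtLettersV2 (GpFrame₂)
open Literature.MathematicalPhysics.QuantumFieldTheory.Balaban1983to89.B9SectBCodedCarrier (CCfg Coding pullK)
open Literature.MathematicalPhysics.QuantumFieldTheory.Balaban1983to89.B6KLevelCensusIndexV1 (KIdx kGeo)
open Literature.MathematicalPhysics.QuantumFieldTheory.Balaban1983to89.B6Ineq2142KLevelV1 (β)
open Literature.MathematicalPhysics.QuantumFieldTheory.Balaban1983to89.B9PinMembersKLevelV1 (MemberY geo9Y bg9Y)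
open Literature.MathematicalPhysics.QuantumFieldTheory.Balaban1983to89.B9GeoLemma21KLevelV1 (geo9Y_dist_self geo9Y_dist_comm geo9Y_dist_triangle geo9Y_len_pos
  geo9K_eta_pos geo9K_one_le_L)
open Literature.MathematicalPhysics.QuantumFieldTheory.Balaban1983to89.B9RWSums347DefiniteFacesWindow (geo9Y_dist_nonneg)
open Literature.MathematicalPhysics.QuantumFieldTheory.Balaban1983to89.B9RWSums347DefiniteFacesWindow (ineq261_fn_geo9Y scaleTransfer6_window_geo9Y)
open Literature.MathematicalPhysics.QuantumFieldTheory.Balaban1983to89.B9Eq360DeltaPrimeAY (AfldY mulY chartA)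
open Literature.MathematicalPhysics.QuantumFieldTheory.Balaban1983to89.B9SectBGpLettersY
open Literature.MathematicalPhysics.QuantumFieldTheory.Balaban1983to89.Node00 (SiteY BlkY IBondY CfgY SiteParY UboxY shiftY deltaPrimeAY)

variable {d ℓ : ℕ} {hd : 1 ≤ d + 1} {hL : Odd (ℓ + 1) ∧ 1 < ℓ + 1} {b₀ b₁ : ℝ} {Mstar : ℕ}
variable {𝔸 : Type} [NormedRing 𝔸] [NormedAlgebra ℂ 𝔸] [CompleteSpace 𝔸] [NormOneClass 𝔸]

/-! ## §1 The coding of the record's backgrounds at a member -/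

section CodingX

variable (G : Subgroup 𝔸ˣ) (x : MemberY d ℓ hd hL b₀ b₁ Mstar)

/-- **THE CODING OF THE MEMBER'S BACKGROUNDS `bg9Y`** (the record's carrier, both (3.35) sequences): multipliers presented by their fields `A′`,
decoded as `e^{iηA′}`; coded complex classes `C37`, `C38` a parameter. [cite: Balaban1985BackgroundPropagators, (3.37) p.396] -/
def codingYx (C37 C38 : ℝ → CfgY 𝔸 x.toKIdx → AfldY 𝔸 x.toKIdx → Prop) : Coding (bg9Y 𝔸 G x) where
  A := AfldY 𝔸 x.toKIdx
  decA := fun a => fluct (kGeo x.toKIdx).eta a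
  C37 := C37
  C38 := C38

omit [NormOneClass 𝔸] in
/-- the coding of `bg9Y` and the coding of `bg9K` at the member's index have the same decoding. [cite: Balaban1985BackgroundPropagators, (3.37) p.396, bookkeeping] -/
theorem codingYx_dec (C37 C38 : ℝ → CfgY 𝔸 x.toKIdx → AfldY 𝔸 x.toKIdx → Prop) (c : CCfg (CfgY 𝔸 x.toKIdx) (AfldY 𝔸 x.toKIdx)) :
    (codingYx G x C37 C38).dec c = decY x.toKIdx c := by
  cases c <;> rfl

end CodingX

/-! ## §2 The residual named statements: the class (3.37) in letters form, the (3.42) reading and writing dictionaries -/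

section Residual

variable (G : Subgroup 𝔸ˣ) (x : MemberY d ℓ hd hL b₀ b₁ Mstar) (par : SiteParY 𝔸 x.toKIdx) {ι : Type} [Fintype ι] (b : Module.Basis ι ℝ 𝔸)
  (ιB : BlkY x.toKIdx → IBondY x.toKIdx) [Fintype (geo9Y x).Site]

/-- **(3.37) IN THE LETTERS FORM THE FRAME CONSUMES** at a (base `U`, multiplier `a`) pair with constant `C_q` at exponent `β`: the seven blockwise
bounds of `GpFrame₂.cplx` for NODE 00's letters — (3.58)∕(3.59) for the variation letters `kF`, `sF`, and (3.37) read blockwise for `A = chartA a`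
(its covariant differences, its values, its backward transports). A named statement (the coded class `C37` is asked to imply it).
[cite: Balaban1985BackgroundPropagators, (3.37) p.396, (3.58)–(3.59) p.402] -/
def CplxLettersY (Cq β : ℝ) (U : CfgY 𝔸 x.toKIdx) (a : AfldY 𝔸 x.toKIdx) : Prop :=
  (∀ (y : IBondY x.toKIdx) (z : SiteY x.toKIdx), blkC x.toKIdx ιB z = y →
      ‖kFC x.toKIdx par (.base U) (.mult a) y z‖ ≤ Cq * β * wC x.toKIdx (.base U) y) ∧
  (∀ z : SiteY x.toKIdx, ‖sFC x.toKIdx par (.base U) (.mult a) z‖ ≤ Cq * β) ∧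
  (∀ (ν k : Fin (d + 1)) (z : SiteY x.toKIdx),
      ‖(((geo9Y x).eta : ℂ))⁻¹ • covDstar (shiftY x.toKIdx) (coordC G x.toKIdx (.base U)) ν (expAC x.toKIdx (.base U) (.mult a) k) z‖ ≤
        β * ((geo9Y x).len (blkC x.toKIdx ιB z) ^ 2)⁻¹) ∧
  (∀ (μ ν : Fin (d + 1)) (z : SiteY x.toKIdx),
      ‖(((geo9Y x).eta : ℂ))⁻¹ • covD (shiftY x.toKIdx) (coordC G x.toKIdx (.base U)) μ (expAC x.toKIdx (.base U) (.mult a) ν) z‖ ≤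
        β * ((geo9Y x).len (blkC x.toKIdx ιB z) ^ 2)⁻¹) ∧
  (∀ (μ : Fin (d + 1)) (z : SiteY x.toKIdx),
      ‖(((geo9Y x).eta : ℂ))⁻¹ • covDstar (shiftY x.toKIdx) (coordC G x.toKIdx (.base U)) μ
          (tauB (shiftY x.toKIdx) (coordC G x.toKIdx (.base U)) μ (expAC x.toKIdx (.base U) (.mult a) μ)) z‖ ≤
        β * ((geo9Y x).len (blkC x.toKIdx ιB z) ^ 2)⁻¹) ∧
  (∀ (k : Fin (d + 1)) (z : SiteY x.toKIdx), ‖expAC x.toKIdx (.base U) (.mult a) k z‖ ≤ β * ((geo9Y x).len (blkC x.toKIdx ιB z))⁻¹) ∧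
  (∀ (ν k : Fin (d + 1)) (z : SiteY x.toKIdx),
      ‖tauB (shiftY x.toKIdx) (coordC G x.toKIdx (.base U)) ν (expAC x.toKIdx (.base U) (.mult a) k) z‖ ≤ β * ((geo9Y x).len (blkC x.toKIdx ιB z))⁻¹)

/-- **THE (3.42) READING DICTIONARY** for a family `KC` over the CODED carrier at the member (named statement): at a (3.35)-regular `U` above the thresholds,
the (3.42) block of `KC` at `base U` with `(B₀, δ)` gives block majorants of the four letters `Gop`, `∇♯_k·Gop`, `Gop·∇♯_k`, `Lap·Gop` at `base U` with `(c_R·B₀, δ)` — the field `GpFrame₂.read342`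
at NODE 00's letters. [cite: Balaban1985BackgroundPropagators, (3.42) p.397; Balaban1984PropagatorsII, (2.51) p.232] -/
def Read342Y (C37 C38 : ℝ → CfgY 𝔸 x.toKIdx → AfldY 𝔸 x.toKIdx → Prop) (KC : B9.KernelFamily (geo9Y x) (codingYx G x C37 C38).bg)
    (c35 cR MInv aInv : ℝ) (Rr : ℝ) (Hp : Prop) : Prop :=
  ∀ (α₀ : ℝ) (U : CfgY 𝔸 x.toKIdx) (B₀ δ : ℝ), MInv ≤ (geo9Y x).M → 0 < α₀ → (geo9Y x).M * α₀ ≤ aInv →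
    (bg9Y 𝔸 G x).Reg335 c35 α₀ U → 0 < B₀ → 0 < δ → EBlock KC B₀ δ (.base U) →
    HasMajorant (g := toB6 (geo9Y x) Rr Hp) (fun p : SiteY x.toKIdx × ι => blkC x.toKIdx ιB p.1) (GopC x.toKIdx par b (.base U))
        (fun a a' => cR * B₀ * (geo9Y x).len a ^ 2 * Real.exp (-(δ * (geo9Y x).dist a a'))) ∧
      (∀ k : Fin (d + 1) ⊕ Fin (d + 1), HasMajorant (g := toB6 (geo9Y x) Rr Hp) (fun p : SiteY x.toKIdx × ι => blkC x.toKIdx ιB p.1)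
        (conj b (diffLetter (shiftY x.toKIdx) (coordC G x.toKIdx (.base U)) ((((geo9Y x).eta : ℂ))⁻¹) k) *
          GopC x.toKIdx par b (.base U))
        (fun a a' => cR * B₀ * (geo9Y x).len a * Real.exp (-(δ * (geo9Y x).dist a a')))) ∧
      (∀ k : Fin (d + 1) ⊕ Fin (d + 1), HasMajorant (g := toB6 (geo9Y x) Rr Hp) (fun p : SiteY x.toKIdx × ι => blkC x.toKIdx ιB p.1)
        (GopC x.toKIdx par b (.base U) *
          conj b (diffLetter (shiftY x.toKIdx) (coordC G x.toKIdx (.base U)) ((((geo9Y x).eta : ℂ))⁻¹) k))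
        (fun a a' => cR * B₀ * (geo9Y x).len a * Real.exp (-(δ * (geo9Y x).dist a a')))) ∧
      HasMajorant (g := toB6 (geo9Y x) Rr Hp) (fun p : SiteY x.toKIdx × ι => blkC x.toKIdx ιB p.1)
        (LapC x.toKIdx b (.base U) * GopC x.toKIdx par b (.base U))
        (fun a a' => cR * B₀ * 1 * Real.exp (-(δ * (geo9Y x).dist a a')))

/-- **THE (3.42) WRITING DICTIONARY** for a family `KC` over the CODED carrier at the member (named statement): block majorants of the four letters of
`G′(U′U)` at the product `prod U a` (difference letters and `Lap` at the real `U`) with `(B, δ)` give the (3.42) block of `KC` AT THE CODED PRODUCT `prod U a`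
(which remembers the base `U`) with `(w_B(B,δ), w_δ(δ))`, for the
pair in the coded class at `α₁ ≦ a_W` — the field `GpFrame₂.write342` at NODE 00's letters. [cite: Balaban1985BackgroundPropagators, (3.42) p.397, p.403; Balaban1984PropagatorsII, (2.51) p.232] -/
def Write342Y (C37 C38 : ℝ → CfgY 𝔸 x.toKIdx → AfldY 𝔸 x.toKIdx → Prop) (KC : B9.KernelFamily (geo9Y x) (codingYx G x C37 C38).bg)
    (wB : ℝ → ℝ → ℝ) (wδ : ℝ → ℝ) (aW : ℝ) (Rr : ℝ) (Hp : Prop) : Prop :=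
  ∀ (U : CfgY 𝔸 x.toKIdx) (a : AfldY 𝔸 x.toKIdx) (α₁ B δ : ℝ), 0 < α₁ → α₁ ≤ aW → C37 α₁ U a → 0 ≤ B → 0 < δ →
    HasMajorant (g := toB6 (geo9Y x) Rr Hp) (fun p : SiteY x.toKIdx × ι => blkC x.toKIdx ιB p.1)
        (GopC x.toKIdx par b (.prod U a))
        (fun a a' => B * (geo9Y x).len a ^ 2 * Real.exp (-(δ * (geo9Y x).dist a a'))) →
    (∀ k : Fin (d + 1) ⊕ Fin (d + 1), HasMajorant (g := toB6 (geo9Y x) Rr Hp) (fun p : SiteY x.toKIdx × ι => blkC x.toKIdx ιB p.1)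
        (conj b (diffLetter (shiftY x.toKIdx) (coordC G x.toKIdx (.base U)) ((((geo9Y x).eta : ℂ))⁻¹) k) *
          GopC x.toKIdx par b (.prod U a))
        (fun a a' => B * (geo9Y x).len a * Real.exp (-(δ * (geo9Y x).dist a a')))) →
    (∀ k : Fin (d + 1) ⊕ Fin (d + 1), HasMajorant (g := toB6 (geo9Y x) Rr Hp) (fun p : SiteY x.toKIdx × ι => blkC x.toKIdx ιB p.1)
        (GopC x.toKIdx par b (.prod U a) *
          conj b (diffLetter (shiftY x.toKIdx) (coordC G x.toKIdx (.base U)) ((((geo9Y x).eta : ℂ))⁻¹) k))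
        (fun a a' => B * (geo9Y x).len a * Real.exp (-(δ * (geo9Y x).dist a a')))) →
    HasMajorant (g := toB6 (geo9Y x) Rr Hp) (fun p : SiteY x.toKIdx × ι => blkC x.toKIdx ιB p.1)
        (LapC x.toKIdx b (.base U) * GopC x.toKIdx par b (.prod U a))
        (fun a a' => B * 1 * Real.exp (-(δ * (geo9Y x).dist a a'))) →
    EBlock KC (wB B δ) (wδ δ) (.prod U a)

end Residual

/-! ## §3 ★★ The root frame `GpFrame₂` over the coded carrier of the record family -/

section Frame

variable (c35 : ℝ) (G : Subgroup 𝔸ˣ) {ι : Type} [Fintype ι] [DecidableEq ι] (b : Module.Basis ι ℝ 𝔸)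
  [∀ x : MemberY d ℓ hd hL b₀ b₁ Mstar, Fintype (geo9Y x).Site] [instDS : ∀ x : MemberY d ℓ hd hL b₀ b₁ Mstar, DecidableEq (geo9Y x).Site]
  [∀ x : MemberY d ℓ hd hL b₀ b₁ Mstar, Nonempty (geo9Y x).Site]
  (C37 C38 : ∀ x : MemberY d ℓ hd hL b₀ b₁ Mstar, ℝ → CfgY 𝔸 x.toKIdx → AfldY 𝔸 x.toKIdx → Prop)
  (par : ∀ x : MemberY d ℓ hd hL b₀ b₁ Mstar, SiteParY 𝔸 x.toKIdx)
  (ιB : ∀ x : MemberY d ℓ hd hL b₀ b₁ Mstar, BlkY x.toKIdx → IBondY x.toKIdx)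
  (KC : ∀ x : MemberY d ℓ hd hL b₀ b₁ Mstar, B9.KernelFamily (geo9Y x) (codingYx G x (C37 x) (C38 x)).bg)

omit [NormOneClass 𝔸] [∀ x : MemberY d ℓ hd hL b₀ b₁ Mstar, DecidableEq (geo9Y x).Site]
  [∀ x : MemberY d ℓ hd hL b₀ b₁ Mstar, Nonempty (geo9Y x).Site] in
/-- the [4] Lemma-2.1 supplier of record as an existential over the family (n06-k's `ineq261_fn_geo9Y` at `αlo = 9/5000`, `R` read as `0`).
[cite: Balaban1984PropagatorsII, Lemma 2.1 (2.61) p.234, (2.59) p.233] -/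
theorem exists_d261 :
    ∃ (d261 : ℝ → ℕ) (M261 : ℝ → ℝ), ∀ (x : MemberY d ℓ hd hL b₀ b₁ Mstar) (δ α : ℝ), 0 < δ → 9 / 5000 ≤ α → α ≤ 1 →
      M261 δ ≤ (geo9Y x).M → Ineq261 (d261 δ) (toB6 (geo9Y x) (0 : ℝ) True) δ α :=
  ineq261_fn_geo9Y (fun _ => (0 : ℝ)) (fun _ => True) (by norm_num)

/-- ★★ **THE ROOT SECT.-B FRAME `GpFrame₂` OVER THE CODED CARRIER OF THE RECORD FAMILY, FROM NODE 00's LETTERS.**  Data: fine carrier `SiteY`, shifts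
`shiftY`, block map `ιB ∘ blkY` (a section `ιB` of `β`), coordinates `coordC` (genuine at G-valued bases, `1` elsewhere), the letters of
`B9SectBGpLettersY` (`kQC sQC kFC sFC wC cfunC expAC ΔpC GopC LapC`), constants `a₀ = 1`, `d₀ = 2(d+1)`, `δcap = 1`, `Λf = L⁴`, `MST δ = 4 log L∕((9/5000)δ)`,
`(d261, M261)` from n06-k's supplier.  Laws DISCHARGED: geometry (tree), (2.61)∕scale transfers (n06-k), `unitary`, stencils (p21's neighbour lemma),
(3.19)∕(3.24) sizes, `gop_eq` (uniqueness of inverses through `conj b`), `reg_inv` (from `hunit`: Δ′_a(U) a unit at G-valued U — Thm 3.11,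
`B9Thm311DeltaPrimePos.isUnit_deltaPrimeAY_parSymY` at the record), ★ `mul_law` ((3.60), `B9Eq360DeltaPrimeAY`).  Laws TAKEN AS NAMED HYPOTHESES:
`hC37` (the coded class implies «U G-valued» and `CplxLettersY`), `hread`∕`hwrite` (`Read342Y`∕`Write342Y`: the conj-`b` reading dictionary of `KC`).
[cite: Balaban1985BackgroundPropagators, Thm 3.4 p.400, (3.60) p.402, Thm 3.1 (3.42) p.397, (3.19) p.393, (3.24)–(3.25) pp.394–395, (3.35)–(3.37) p.396, Thm 3.11 p.416; Balaban1984PropagatorsII, Lemma 2.1 p.234, (2.51) p.232] -/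
def gpFrame₂Coded (hι : ∀ (x : MemberY d ℓ hd hL b₀ b₁ Mstar) (s : BlkY x.toKIdx), β x.toKIdx.hN x.toKIdx.D x.toKIdx.hk (ιB x s) = s)
    (hG1 : ∀ u : 𝔸ˣ, u ∈ G → ‖(u : 𝔸)‖ ≤ 1) (hpar : ∀ x (U : CfgY 𝔸 x.toKIdx), GVal G x.toKIdx U → ∀ z w, par x U z w ∈ G)
    (hunit : ∀ x (U : CfgY 𝔸 x.toKIdx), GVal G x.toKIdx U → IsUnit (deltaPrimeAY x.toKIdx (par x) U))
    (dB : ℕ) (M₂ : ℝ) (hM₂ : 0 ≤ M₂) (hrepr : ∀ (v : 𝔸) (j : ι), |b.repr v j| ≤ M₂ * ‖v‖)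
    (Cq : ℝ) (hCq : 0 ≤ Cq) (hC37 : ∀ x β U a, C37 x β U a → GVal G x.toKIdx U ∧ CplxLettersY G x (par x) (ιB x) Cq β U a)
    (cR : ℝ) (hcR : 0 < cR) (wBf : ℝ → ℝ → ℝ) (hwBf : ∀ B δ : ℝ, 0 ≤ B → 0 < δ → 0 < wBf B δ) (wδf : ℝ → ℝ) (hwδf : ∀ δ : ℝ, 0 < δ → 0 < wδf δ)
    (MInv aInv aW : ℝ) (hMInv : 0 < MInv) (haInv : 0 < aInv) (haW : 0 < aW)
    (hread : ∀ x, Read342Y G x (par x) b (ιB x) (C37 x) (C38 x) (KC x) c35 cR MInv aInv 0 True)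
    (hwrite : ∀ x, Write342Y G x (par x) b (ιB x) (C37 x) (C38 x) (KC x) wBf wδf aW 0 True) :
    GpFrame₂ c35 geo9Y (fun x => (codingYx G x (C37 x) (C38 x)).bg) KC b (Fin (d + 1)) (fun x => SiteY x.toKIdx) where
  dB := dB
  Cq := Cq
  a₀ := 1
  d₀ := 2 * ((d : ℝ) + 1)
  M₂ := M₂
  Λf := fun _ _ => ((ℓ : ℝ) + 1) ^ 4
  cR := cR
  wB := wBf
  wδ := wδf
  MInv := MInv
  aInv := aInv
  aW := aW
  δcap := 1
  M261 := Classical.choose (Classical.choose_spec (exists_d261 (d := d) (ℓ := ℓ) (hd := hd) (hL := hL) (b₀ := b₀) (b₁ := b₁) (Mstar := Mstar)))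
  MST := fun δ => 4 * Real.log ((ℓ : ℝ) + 1) / (9 / 5000 * δ)
  d261 := Classical.choose (exists_d261 (d := d) (ℓ := ℓ) (hd := hd) (hL := hL) (b₀ := b₀) (b₁ := b₁) (Mstar := Mstar))
  Cq_nonneg := hCq
  a₀_nonneg := zero_le_one
  M₂_nonneg := hM₂
  Λf_one_le := fun _ _ _ _ => one_le_pow₀ (by have : (0 : ℝ) ≤ ℓ := Nat.cast_nonneg _; linarith)
  cR_pos := hcR
  wB_pos := hwBf
  wδ_pos := hwδf
  MInv_pos := hMInv
  aInv_pos := haInv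
  aW_pos := haW
  δcap_pos := one_pos
  hrepr := hrepr
  T := fun x => shiftY x.toKIdx
  blk := fun x => blkC x.toKIdx (ιB x)
  Rr := fun _ => 0
  Hp := fun _ => True
  coord := fun x => coordC G x.toKIdx
  kQ := fun x => kQC G x.toKIdx (par x)
  sQ := fun x => sQC G x.toKIdx (par x)
  w := fun x => wC x.toKIdx
  cfun := fun x => cfunC x.toKIdx
  expA := fun x => expAC x.toKIdx
  kF := fun x => kFC x.toKIdx (par x)
  sF := fun x => sFC x.toKIdx (par x)
  Δp := fun x => ΔpC x.toKIdx (par x) b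
  Gop := fun x => GopC x.toKIdx (par x) b
  Lap := fun x => LapC x.toKIdx b
  dist_nonneg := fun x => geo9Y_dist_nonneg x
  triangle := fun x => fun a bb c => geo9Y_dist_triangle x a bb c
  dist_self := fun x => geo9Y_dist_self x
  dist_comm := fun x => geo9Y_dist_comm x
  len_pos := fun x => geo9Y_len_pos x
  eta_le_len := fun x y => by
    show (geo9Y x).eta ≤ (geo9Y x).L ^ (geo9Y x).scale y * (geo9Y x).eta
    exact le_mul_of_one_le_left (geo9K_eta_pos x.toKIdx).le (one_le_pow₀ (geo9K_one_le_L x.toKIdx))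
  eta_pos := fun x => geo9K_eta_pos x.toKIdx
  h261 := fun x δ α hδ _ hα hα1 hM =>
    Classical.choose_spec (Classical.choose_spec (exists_d261 (d := d) (ℓ := ℓ) (hd := hd) (hL := hL) (b₀ := b₀) (b₁ := b₁) (Mstar := Mstar)))
      x δ α hδ hα hα1.le hM
  hST := fun x δ α hδ _ hα hM => by
    have hκlo : 0 < 9 / 5000 * δ := by positivity
    have hκ : 9 / 5000 * δ ≤ α * δ := mul_le_mul_of_nonneg_right hα hδ.le
    exact scaleTransfer6_window_geo9Y hκlo x hκ hM
  unitary := fun x c m z => coordC_unitary G x.toKIdx hG1 c m z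
  stencilB := fun x μ z => stencilB_blkC x.toKIdx (ιB x) (hι x) μ z
  stencilF := fun x μ z => stencilF_blkC x.toKIdx (ιB x) (hι x) μ z
  stencil0 := fun x y => stencil0_geo9K x.toKIdx y
  w_nonneg := fun x c y => wC_nonneg x.toKIdx c y
  card_w := fun x c y => card_blkC_mul_wC_le x.toKIdx (ιB x) (instD := instDS x) (hι x) c y
  hkQ := fun x c y z _ => kQC_norm_le G x.toKIdx (par x) hG1 (hpar x) c y z
  hsQ := fun x c z => sQC_norm_le G x.toKIdx (par x) hG1 (hpar x) c z
  hcfun := fun x y => cfunC_abs_le x.toKIdx y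
  gop_eq := fun x c D X hD hDX hXD => gopC_eq x.toKIdx (par x) b c D X hD hDX hXD
  reg_inv := fun x α₀ c _ _ _ hreg => by
    obtain ⟨U, rfl, hU⟩ := (codingYx G x (C37 x) (C38 x)).exists_of_bg_Reg335 hreg
    exact ΔpC_mul_GopC x.toKIdx (par x) b (.base U) (hunit x U hU.1.1)
  cplx := fun x α₁ c c' _ h37 => by
    obtain ⟨U, a, rfl, rfl, hC⟩ := (codingYx G x (C37 x) (C38 x)).exists_of_bg_Cplx337 h37
    exact (hC37 x α₁ U a hC).2
  mul_law := fun x α₁ c c' _ h37 => by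
    obtain ⟨U, a, rfl, rfl, hC⟩ := (codingYx G x (C37 x) (C38 x)).exists_of_bg_Cplx337 h37
    exact ΔpC_mul_law G x.toKIdx (par x) b (ιB x) (instD := instDS x) (hι x) (hC37 x α₁ U a hC).1 a
  read342 := fun x α₀ c B₀ δ hM hα₀ hMa hreg hB₀ hδ hE => by
    obtain ⟨U, rfl, hU⟩ := (codingYx G x (C37 x) (C38 x)).exists_of_bg_Reg335 hreg
    exact hread x α₀ U B₀ δ hM hα₀ hMa hU hB₀ hδ hE
  write342 := fun x c c' α₁ B δ hα₁ hα₁W h37 hB hδ hG hDG hGD hLG => by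
    obtain ⟨U, a, rfl, rfl, hC⟩ := (codingYx G x (C37 x) (C38 x)).exists_of_bg_Cplx337 h37
    exact hwrite x U a α₁ B δ hα₁ hα₁W hC hB hδ hG hDG hGD hLG

end Frame

end Literature.MathematicalPhysics.QuantumFieldTheory.Balaban1983to89.B9SectBGpFrameCodedY
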